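import Literature.Analysis.FluidPDE.TaoBandHeatGroup
import Literature.Analysis.FluidPDE.TaoMildSolutionBounds
import Mathlib.Analysis.Calculus.ContDiff.Deriv
import Mathlib.Analysis.Calculus.Deriv.MeanValue
import HarnessLib

/-!
# Tao's averaged Navier–Stokes blow-up: the projected Duhamel formula of Lemma 4.1 holds in `L²`

T. Tao, *Finite time blowup for an averaged three-dimensional Navier–Stokes equation*,
J. Amer. Math. Soc. **29** (2016), 601–674 = arXiv:1402.0290v3 (held as `paper:arxiv-1402.0290`),
§4, proof of Lemma 4.1, p. 22: "Taking inner products of (4.14) with `ψ_{i,n}`, we have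
`u_{i,n}(t) = e^{tΔ} X_{i,n}(0) ψ_{i,n} + Σ α (1+ε₀)^{5(n-μ₃)/2} ∫₀ᵗ X X e^{(t-t')Δ} ψ_{i,n} dt'`
or in differentiated form … `∂ₜ u_{i,n} = Δ u_{i,n} + Σ … ψ_{i,n}` (4.15)."

The in-tree mild formulation (`IsMildSolutionFor`, (1.15)/(3.3)) is an identity in
`(H¹⁰_df)*`: it is *tested* against `w ∈ H¹⁰_df`. This file upgrades it, for each mode `(i,n)`, to
the **identity of `L²` fields** `u_{i,n}(t) = V_{i,n}(t)` (`modeProjection_eq_modeDuhamel`), where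
`V_{i,n}` is the Duhamel element of `TaoBandHeatGroup.lean` on the band `(1+ε₀)ⁿ(Bᵢ ∪ -Bᵢ)` driven
by `G_{i,n}(t) = quadTermC(u(t))_{i,n}`: test the mild identity with band-limited `w ∈ H¹⁰_df`
(there `⟨C(u,u), e^{(t-s)Δ} w⟩` collapses to `G_{i,n}(s) ⟨e^{(t-s)Δ}w, ψ_{i,n}⟩`, accepted
`cascadeOperatorForm_eq_quadTermC_mul`), move everything to one side as `⟪w, u_{i,n}(t) - V(t)⟫ = 0`,
and take `w = Re D`, `Im D` of `D = u_{i,n}(t) - V(t)` itself (band-limited, divergence free —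
`isFourierDivFree_duhamelV` — hence in `H¹⁰_df ⊗ ℂ = H¹⁰_df ⊕ i H¹⁰_df`).

Consequences recorded here, in the notation of the accepted `modeCoeff` / `modeEnergy` and with
`G` real (`driveC_eq_ofReal`): `E_{i,n} = ½‖V‖²` and `X_{i,n} = Re ⟪ψ_{i,n}, V⟫` on `[0,∞)`
(`modeEnergy_eq`, `modeCoeff_eq`), `u(0) = u₀` in `L²` (`mild_initial_eq`), and the initial
projections (`modeProjection_datum`).

## References

* T. Tao, J. Amer. Math. Soc. 29 (2016), 601–674, arXiv:1402.0290v3, §4 Lemma 4.1, p. 22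
  ((4.14), (4.15)). Key `Tao2016AveragedNS`.
-/

noncomputable section

open MeasureTheory Set Filter FourierTransform Metric
open scoped ENNReal NNReal ComplexConjugate InnerProductSpace Topology

namespace Literature.Analysis.FluidPDE.Tao2016

/-- Local notation for physical / frequency space `ℝ³`. -/
local notation "ℝ³" => EuclideanSpace ℝ (Fin 3)
/-- Local notation for the complexified range `ℂ³`. -/
local notation "ℂ³" => EuclideanSpace ℂ (Fin 3)

variable {ε₀ : ℝ} {m : ℕ}

/-! ### The mode regions as bands -/

/-- The region of the mode `(i,n)` lies in the ball of radius `(1+ε₀)ⁿ(1+ε₀/2)`. [cite: Tao2016AveragedNS, Lemma 4.1] -/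
theorem freqRegion_subset_closedBall (hε : 0 < 1 + ε₀) (𝒟 : CascadeWaveletData ε₀ m) (i : Fin m) (n : ℤ) :
    freqRegion 𝒟 i n ⊆ closedBall (0 : ℝ³) ((1 + ε₀) ^ n * (1 + ε₀ / 2)) := fun ξ hξ => by
  simpa [mem_closedBall] using (𝒟.norm_of_mem_freqRegion hε i n hξ).2

/-- The region of a mode is symmetric under `ξ ↦ -ξ`. [cite: Tao2016AveragedNS, Lemma 4.1] -/
theorem freqRegion_symm (𝒟 : CascadeWaveletData ε₀ m) (i : Fin m) (n : ℤ) (ξ : ℝ³) :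
    ξ ∈ freqRegion 𝒟 i n ↔ -ξ ∈ freqRegion 𝒟 i n :=
  (neg_mem_freqRegion_iff 𝒟 i n ξ).symm

/-- The wavelet `ψ_{i,n}` is band-limited to the region of its mode. [cite: Tao2016AveragedNS, Lemma 4.1] -/
theorem cascadeWavelet_isBandLimited (hε : 0 < 1 + ε₀) (𝒟 : CascadeWaveletData ε₀ m) (i : Fin m) (n : ℤ) :
    IsBandLimited (freqRegion 𝒟 i n) (cascadeWavelet ε₀ (𝒟.ψ i) n) :=
  𝒟.fourierFn_cascadeWavelet_eq_zero hε i n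

/-- On the region of the mode `(i,n)`, the Fourier transform of every *other* wavelet vanishes. [cite: Tao2016AveragedNS, Lemma 4.1] -/
theorem fourierFn_cascadeWavelet_eq_zero_on (hε₀ : 0 < ε₀) (𝒟 : CascadeWaveletData ε₀ m) {i j : Fin m}
    {n k : ℤ} (hne : (j, k) ≠ (i, n)) :
    ∀ᵐ ξ ∂(volume : Measure ℝ³), ξ ∈ freqRegion 𝒟 i n → fourierFn (cascadeWavelet ε₀ (𝒟.ψ j) k) ξ = 0 := by
  filter_upwards [𝒟.fourierFn_cascadeWavelet_eq_zero (by linarith) j k] with ξ h hξ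
  exact h (𝒟.not_mem_freqRegion_of_ne hε₀ (fun h' => hne h'.symm) hξ)

/-- The heat flow preserves band-limitedness. [folklore] -/
theorem heat_isBandLimited {R : Set ℝ³} {f : L2C} (hf : IsBandLimited R f) (τ : ℝ) :
    IsBandLimited R (heat τ f) :=
  hf.fourierMultiplier _

/-- The mode projection `u_{i,n}` is band-limited to the region of the mode. [cite: Tao2016AveragedNS, Lemma 4.1] -/
theorem modeProjection_isBandLimited (𝒟 : CascadeWaveletData ε₀ m) (i : Fin m) (n : ℤ) (f : L2C) :
    IsBandLimited (freqRegion 𝒟 i n) (modeProjection 𝒟 i n f) :=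
  isBandLimited_bandProj (measurableSet_freqRegion 𝒟 i n) f

/-- **A field band-limited to the region of `(i,n)` pairs to zero with every other wavelet**
(the hypothesis of the accepted `cascadeOperatorForm_eq_quadTermC_mul`). [cite: Tao2016AveragedNS, Lemma 4.1] -/
theorem pairing_cascadeWavelet_eq_zero_of_isBandLimited (hε₀ : 0 < ε₀) (𝒟 : CascadeWaveletData ε₀ m)
    {i : Fin m} {n : ℤ} {g : L2C} (hg : IsBandLimited (freqRegion 𝒟 i n) g) (j : Fin m) (k : ℤ)
    (hne : (j, k) ≠ (i, n)) : pairing g (cascadeWavelet ε₀ (𝒟.ψ j) k) = 0 := by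
  rw [pairing_eq_inner (isReal_cascadeWavelet ε₀ (𝒟.ψ j) k)]
  exact (hg.inner_eq_zero_of_ae (fourierFn_cascadeWavelet_eq_zero_on hε₀ 𝒟 hne)).2

/-- Testing against a band-limited field only sees the projection: `⟪w, f⟫ = ⟪w, f_{i,n}⟫`. [folklore] -/
theorem inner_modeProjection_eq_of_isBandLimited (𝒟 : CascadeWaveletData ε₀ m) (i : Fin m) (n : ℤ)
    {w : L2C} (hw : IsBandLimited (freqRegion 𝒟 i n) w) (f : L2C) :
    ⟪w, modeProjection 𝒟 i n f⟫_ℂ = ⟪w, f⟫_ℂ := by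
  refine hw.inner_fourierMultiplier_eq_inner _ ?_ f
  filter_upwards [MemLp.coeFn_toLp (memLp_top_indicator_one (measurableSet_freqRegion 𝒟 i n))] with ξ h hξ
  rw [h, indicator_of_mem hξ]

/-! ### The drive `G_{i,n}` of the mode equation -/

section Drive

variable (𝒟 : CascadeWaveletData ε₀ m) (α : Fin m → Fin m → Fin m → ℤ × ℤ × ℤ → ℝ) (u : ℝ → L2C)

/-- The **drive of the mode `(i,n)`**, `G_{i,n}(s) = quadTermC(u(s))_{i,n}` for `s ≥ 0`, extended
to negative times by its value structure at `u(max s 0)` (values of `u` at `t < 0` are never used).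
For the real fields of a mild solution it is the accepted real `quadTerm` of the coefficients
`X_{j,k}` (`driveC_eq_ofReal`). [cite: Tao2016AveragedNS, §4 (4.10)] -/
def driveC (i : Fin m) (n : ℤ) (s : ℝ) : ℂ :=
  quadTermC ε₀ 𝒟.ψ α (u (max s 0)) i n

variable {𝒟 α u}

/-- Clamping time at `0` turns a curve continuous on `[0,∞)` into a continuous curve. [folklore] -/
theorem continuous_clamp (hc : ContinuousOn u (Ici 0)) : Continuous fun s : ℝ => u (max s 0) :=
  hc.comp_continuous (continuous_id.max continuous_const) fun s => mem_Ici.2 (le_max_right s 0)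

/-- The pairing `⟨f, ψ⟩` with a real field `ψ` is continuous in `f`. [folklore] -/
theorem continuous_pairing_left {ψ : L2C} (hψ : IsReal ψ) : Continuous fun f : L2C => pairing f ψ := by
  have h : (fun f : L2C => pairing f ψ) = fun f => ⟪ψ, f⟫_ℂ := funext fun f => pairing_eq_inner hψ
  rw [h]
  exact continuous_const.inner continuous_id

/-- The complex quadratic term is continuous in the field. [folklore] -/
theorem continuous_quadTermC (i : Fin m) (n : ℤ) : Continuous fun f : L2C => quadTermC ε₀ 𝒟.ψ α f i n := by
  unfold quadTermC
  refine continuous_finsetSum _ fun i₁ _ => continuous_finsetSum _ fun i₂ _ =>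
    continuous_finsetSum _ fun μ _ => ?_
  exact continuous_const.mul ((continuous_pairing_left (isReal_cascadeWavelet _ _ _)).mul
    (continuous_pairing_left (isReal_cascadeWavelet _ _ _)))

/-- **The drive is continuous** when `u` is `L²`-continuous on `[0,∞)`. [folklore] -/
theorem continuous_driveC (hc : ContinuousOn u (Ici 0)) (i : Fin m) (n : ℤ) :
    Continuous (driveC 𝒟 α u i n) :=
  (continuous_quadTermC (𝒟 := 𝒟) (α := α) i n).comp (continuous_clamp hc)

/-- **The drive is real**: on real fields, `G_{i,n}(s)` is the accepted real `quadTerm` of the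
coefficients `X_{j,k} = Re⟨u, ψ_{j,k}⟩`, evaluated at `max s 0`. [cite: Tao2016AveragedNS, §4 (4.10)] -/
theorem driveC_eq_ofReal (hreal : ∀ t ∈ Ici (0 : ℝ), IsReal (u t)) (i : Fin m) (n : ℤ) (s : ℝ) :
    driveC 𝒟 α u i n s =
      ((TaoCascade.quadTerm ε₀ α (modeCoeff 𝒟 u) i n (max s 0) : ℝ) : ℂ) := by
  unfold driveC
  rw [quadTermC_eq_ofReal (hreal _ (le_max_right s 0))]
  rfl

/-- For `s ≥ 0`, `G_{i,n}(s) = quadTerm(X)_{i,n}(s)`. [cite: Tao2016AveragedNS, §4 (4.10)] -/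
theorem driveC_eq_ofReal_of_nonneg (hreal : ∀ t ∈ Ici (0 : ℝ), IsReal (u t)) (i : Fin m) (n : ℤ)
    {s : ℝ} (hs : 0 ≤ s) :
    driveC 𝒟 α u i n s = ((TaoCascade.quadTerm ε₀ α (modeCoeff 𝒟 u) i n s : ℝ) : ℂ) := by
  rw [driveC_eq_ofReal hreal, max_eq_left hs]

/-- The drive has vanishing imaginary part. [folklore] -/
theorem driveC_im (hreal : ∀ t ∈ Ici (0 : ℝ), IsReal (u t)) (i : Fin m) (n : ℤ) (s : ℝ) :
    (driveC 𝒟 α u i n s).im = 0 := by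
  rw [driveC_eq_ofReal hreal, Complex.ofReal_im]

/-- For `s ≥ 0` the drive is the complex quadratic term of `u(s)` itself. [folklore] -/
theorem driveC_of_nonneg (i : Fin m) (n : ℤ) {s : ℝ} (hs : 0 ≤ s) :
    driveC 𝒟 α u i n s = quadTermC ε₀ 𝒟.ψ α (u s) i n := by
  rw [driveC, max_eq_left hs]

end Drive

/-! ### The Duhamel element of a mode -/

section ModeDuhamel

variable (hε : 0 < 1 + ε₀) (𝒟 : CascadeWaveletData ε₀ m) (α : Fin m → Fin m → Fin m → ℤ × ℤ × ℤ → ℝ)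
  (i₀ : Fin m) (n₀ : ℤ) (u : ℝ → L2C)

/-- **The Duhamel element of the mode `(i,n)`** (Tao's right-hand side of the projected Duhamel
formula, p. 22): `V_{i,n}(t) = S(t) u₀ + ∫₀ᵗ G_{i,n}(s) S(t-s) ψ_{i,n} ds` on the band of the mode,
with datum `u₀ = ψ_{i₀,n₀}` (4.4) and drive `G_{i,n}`; built from the accepted `duhamelV`. [cite: Tao2016AveragedNS, §4 (4.14)] -/
def modeDuhamel (i : Fin m) (n : ℤ) (t : ℝ) : L2C :=
  duhamelV (measurableSet_freqRegion 𝒟 i n) (freqRegion_subset_closedBall hε 𝒟 i n)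
    (driveC 𝒟 α u i n) (cascadeWavelet ε₀ (𝒟.ψ i₀) n₀) (cascadeWavelet ε₀ (𝒟.ψ i) n) t

variable {𝒟 α i₀ n₀ u}

/-- The band heat flow of a mode, at nonnegative time, is the accepted heat flow followed by the
mode projection. [folklore] -/
theorem bandHeat_freqRegion_eq (i : Fin m) (n : ℤ) {τ : ℝ} (hτ : 0 ≤ τ) (f : L2C) :
    bandHeat (measurableSet_freqRegion 𝒟 i n) (freqRegion_subset_closedBall hε 𝒟 i n) τ f =
      modeProjection 𝒟 i n (heat τ f) :=
  bandHeat_eq_bandProj_heat _ _ hτ f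

/-- On a field band-limited to the mode, the band heat flow is the heat flow (`τ ≥ 0`). [folklore] -/
theorem bandHeat_freqRegion_eq_heat (i : Fin m) (n : ℤ) {τ : ℝ} (hτ : 0 ≤ τ) {w : L2C}
    (hw : IsBandLimited (freqRegion 𝒟 i n) w) :
    bandHeat (measurableSet_freqRegion 𝒟 i n) (freqRegion_subset_closedBall hε 𝒟 i n) τ w = heat τ w := by
  rw [bandHeat_freqRegion_eq hε i n hτ]
  exact (heat_isBandLimited hw τ).bandProj_eq (measurableSet_freqRegion 𝒟 i n)

variable (hu : IsMildSolutionFor (cascadeOperatorForm ε₀ 𝒟.ψ α) (cascadeWavelet ε₀ (𝒟.ψ i₀) n₀) (Ici 0) u)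
include hu

/-- The fields of a mild solution are real at nonnegative times. [folklore] -/
theorem IsMildSolutionFor.isReal_of_nonneg : ∀ t ∈ Ici (0 : ℝ), IsReal (u t) :=
  fun t ht => (hu.1 t ht).2.1

/-- A mild solution is `L²`-continuous on `[0,∞)`. [folklore] -/
theorem IsMildSolutionFor.continuousOn_Ici : ContinuousOn u (Ici 0) :=
  hu.2.1.continuousOn

/-- **The mild identity tested with a band-limited field**: for `w ∈ H¹⁰_df` band-limited to the
region of `(i,n)` and `t ≥ 0`,
`⟨u(t), w⟩ = ⟨e^{tΔ}u₀, w⟩ + ∫₀ᵗ G_{i,n}(s) ⟨e^{(t-s)Δ} w, ψ_{i,n}⟩ ds`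
("taking inner products of (4.14) with `ψ_{i,n}`", p. 22; here with any band-limited test field). [cite: Tao2016AveragedNS, §4 (4.14)] -/
theorem IsMildSolutionFor.pairing_eq_of_isBandLimited (hε₀ : 0 < ε₀) {i : Fin m} {n : ℤ} {t : ℝ}
    (ht : 0 ≤ t) {w : L2C} (hw : MemH10df w) (hwb : IsBandLimited (freqRegion 𝒟 i n) w) :
    pairing (u t) w = pairing (heat t (cascadeWavelet ε₀ (𝒟.ψ i₀) n₀)) w +
      ∫ s in (0 : ℝ)..t, driveC 𝒟 α u i n s * pairing (heat (t - s) w) (cascadeWavelet ε₀ (𝒟.ψ i) n) := by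
  rw [hu.2.2 t ht w hw]
  congr 1
  refine intervalIntegral.integral_congr fun s hs => ?_
  rw [uIcc_of_le ht] at hs
  rw [driveC_of_nonneg i n hs.1]
  exact cascadeOperatorForm_eq_quadTermC_mul (u s) (heat (t - s) w) i n
    fun j k hjk => pairing_cascadeWavelet_eq_zero_of_isBandLimited hε₀ 𝒟 (heat_isBandLimited hwb (t - s)) j k hjk

/-- **The same identity in inner-product form**: `⟪w, u_{i,n}(t)⟫ = ⟪w, V_{i,n}(t)⟫` for every
`w ∈ H¹⁰_df` band-limited to the region of `(i,n)`, `t ≥ 0`. [cite: Tao2016AveragedNS, §4 (4.14)] -/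
theorem IsMildSolutionFor.inner_modeProjection_eq_inner_modeDuhamel (hε₀ : 0 < ε₀) {i : Fin m} {n : ℤ}
    {t : ℝ} (ht : 0 ≤ t) {w : L2C} (hw : MemH10df w) (hwb : IsBandLimited (freqRegion 𝒟 i n) w) :
    ⟪w, modeProjection 𝒟 i n (u t)⟫_ℂ = ⟪w, modeDuhamel hε 𝒟 α i₀ n₀ u i n t⟫_ℂ := by
  set hR := measurableSet_freqRegion 𝒟 i n
  set hρ := freqRegion_subset_closedBall hε 𝒟 i n
  have hcont : Continuous (driveC 𝒟 α u i n) := continuous_driveC hu.continuousOn_Ici i n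
  have hpair := hu.pairing_eq_of_isBandLimited hε₀ ht hw hwb
  -- convert every pairing into an inner product against `w`
  have h1 : pairing (u t) w = ⟪w, modeProjection 𝒟 i n (u t)⟫_ℂ := by
    rw [pairing_eq_inner hw.2.1, inner_modeProjection_eq_of_isBandLimited 𝒟 i n hwb]
  have h2 : pairing (heat t (cascadeWavelet ε₀ (𝒟.ψ i₀) n₀)) w =
      ⟪w, bandHeat hR hρ t (cascadeWavelet ε₀ (𝒟.ψ i₀) n₀)⟫_ℂ := by
    rw [pairing_eq_inner hw.2.1, bandHeat_freqRegion_eq hε i n ht,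
      inner_modeProjection_eq_of_isBandLimited 𝒟 i n hwb]
  have h3 : ∀ s ∈ uIcc 0 t, driveC 𝒟 α u i n s * pairing (heat (t - s) w) (cascadeWavelet ε₀ (𝒟.ψ i) n) =
      ⟪w, driveC 𝒟 α u i n s • bandHeat hR hρ (t - s) (cascadeWavelet ε₀ (𝒟.ψ i) n)⟫_ℂ := by
    intro s hs
    rw [uIcc_of_le ht] at hs
    have hts : 0 ≤ t - s := sub_nonneg.2 hs.2
    rw [inner_smul_right, IsReal.pairing_eq_inner ((hw.2.1).heat (t - s)),
      ← bandHeat_freqRegion_eq_heat hε i n hts hwb, inner_bandHeat_comm]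
  have h3' : ∫ s in (0 : ℝ)..t, driveC 𝒟 α u i n s * pairing (heat (t - s) w) (cascadeWavelet ε₀ (𝒟.ψ i) n) =
      ∫ s in (0 : ℝ)..t, ⟪w, driveC 𝒟 α u i n s • bandHeat hR hρ (t - s) (cascadeWavelet ε₀ (𝒟.ψ i) n)⟫_ℂ :=
    intervalIntegral.integral_congr h3
  have h4 : ∫ s in (0 : ℝ)..t, ⟪w, driveC 𝒟 α u i n s • bandHeat hR hρ (t - s) (cascadeWavelet ε₀ (𝒟.ψ i) n)⟫_ℂ =
      ⟪w, ∫ s in (0 : ℝ)..t, driveC 𝒟 α u i n s • bandHeat hR hρ (t - s) (cascadeWavelet ε₀ (𝒟.ψ i) n)⟫_ℂ := by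
    have hint : IntervalIntegrable
        (fun s => driveC 𝒟 α u i n s • bandHeat hR hρ (t - s) (cascadeWavelet ε₀ (𝒟.ψ i) n)) volume 0 t :=
      (hcont.smul (((continuous_bandHeat hR hρ).comp (continuous_const.sub continuous_id)).clm_apply
        continuous_const)).intervalIntegrable 0 t
    have h := (innerSL ℂ w).intervalIntegral_comp_comm hint
    simpa only [innerSL_apply_apply] using h
  rw [h1, h2, h3', h4] at hpair
  rw [hpair, ← inner_add_right, modeDuhamel, duhamelV_eq hR hρ hcont]

/-- **The projected Duhamel formula holds in `L²`**: `u_{i,n}(t) = V_{i,n}(t)` for `t ≥ 0`,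
i.e. `u_{i,n}(t) = e^{tΔ} (u₀)_{i,n} + ∫₀ᵗ G_{i,n}(s) e^{(t-s)Δ} ψ_{i,n} ds` as `L²` fields
(Tao, p. 22, (4.14) projected to the mode). The difference `D` is band-limited and divergence free,
so `Re D`, `Im D ∈ H¹⁰_df` are admissible band-limited test fields, and `⟪D, D⟫ = 0`. [cite: Tao2016AveragedNS, §4 (4.14)] -/
theorem IsMildSolutionFor.modeProjection_eq_modeDuhamel (hε₀ : 0 < ε₀) (i : Fin m) (n : ℤ) {t : ℝ}
    (ht : 0 ≤ t) : modeProjection 𝒟 i n (u t) = modeDuhamel hε 𝒟 α i₀ n₀ u i n t := by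
  set hR := measurableSet_freqRegion 𝒟 i n
  set hρ := freqRegion_subset_closedBall hε 𝒟 i n
  set D : L2C := modeProjection 𝒟 i n (u t) - modeDuhamel hε 𝒟 α i₀ n₀ u i n t with hD
  have hcont : Continuous (driveC 𝒟 α u i n) := continuous_driveC hu.continuousOn_Ici i n
  have hsymm : ∀ ξ : ℝ³, -ξ ∈ freqRegion 𝒟 i n → ξ ∈ freqRegion 𝒟 i n :=
    fun ξ h => (freqRegion_symm 𝒟 i n ξ).2 h
  -- `D` is band-limited and divergence free, hence in `H¹⁰_df ⊗ ℂ`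
  have hDb : IsBandLimited (freqRegion 𝒟 i n) D :=
    (modeProjection_isBandLimited 𝒟 i n (u t)).sub (isBandLimited_duhamelV hR hρ _ _ t)
  have hDd : IsFourierDivFree D := by
    have h1 : IsFourierDivFree (modeProjection 𝒟 i n (u t)) := (hu.1 t ht).2.2.modeProjection 𝒟 i n
    have h2 : IsFourierDivFree (modeDuhamel hε 𝒟 α i₀ n₀ u i n t) :=
      isFourierDivFree_duhamelV hR hρ hcont _ _ (𝒟.isFourierDivFree_cascadeWavelet hε i₀ n₀)
        (𝒟.isFourierDivFree_cascadeWavelet hε i n) t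
    rw [hD, sub_eq_add_neg, ← neg_one_smul ℂ (modeDuhamel hε 𝒟 α i₀ n₀ u i n t)]
    exact h1.add (h2.smul _)
  have hDC : MemH10dfC D := hDb.memH10dfC hρ hDd
  -- test with `Re D` and `Im D`
  have htest : ∀ {w : L2C}, MemH10df w → IsBandLimited (freqRegion 𝒟 i n) w → ⟪w, D⟫_ℂ = 0 := by
    intro w hw hwb
    rw [hD, inner_sub_right, hu.inner_modeProjection_eq_inner_modeDuhamel hε hε₀ ht hw hwb, sub_self]
  have hre := htest hDC.memH10df_reL2 (hDb.reL2 hsymm)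
  have him := htest hDC.memH10df_imL2 (hDb.imL2 hsymm)
  have hself : ⟪D, D⟫_ℂ = 0 := by
    have h : ⟪reL2 D + Complex.I • imL2 D, D⟫_ℂ = 0 := by
      rw [inner_add_left, inner_smul_left, hre, him, mul_zero, add_zero]
    rwa [reL2_add_I_smul_imL2] at h
  exact sub_eq_zero.1 (inner_self_eq_zero.1 hself)

/-- **The local energy is the energy of the Duhamel element**: `E_{i,n}(t) = ½ ‖V_{i,n}(t)‖²`
for `t ≥ 0`. [cite: Tao2016AveragedNS, Lemma 4.1 (4.5)] -/
theorem IsMildSolutionFor.modeEnergy_eq (hε₀ : 0 < ε₀) (i : Fin m) (n : ℤ) {t : ℝ} (ht : 0 ≤ t) :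
    modeEnergy 𝒟 u i n t = ‖modeDuhamel hε 𝒟 α i₀ n₀ u i n t‖ ^ 2 / 2 := by
  rw [modeEnergy, hu.modeProjection_eq_modeDuhamel hε hε₀ i n ht]

/-- **The coefficient is a coefficient of the Duhamel element**:
`X_{i,n}(t) = Re ⟪ψ_{i,n}, V_{i,n}(t)⟫` for `t ≥ 0` (`⟨u, ψ_{i,n}⟩ = ⟨u_{i,n}, ψ_{i,n}⟩`, p. 21). [cite: Tao2016AveragedNS, Lemma 4.1] -/
theorem IsMildSolutionFor.modeCoeff_eq (hε₀ : 0 < ε₀) (i : Fin m) (n : ℤ) {t : ℝ} (ht : 0 ≤ t) :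
    modeCoeff 𝒟 u i n t = (⟪cascadeWavelet ε₀ (𝒟.ψ i) n, modeDuhamel hε 𝒟 α i₀ n₀ u i n t⟫_ℂ).re := by
  rw [modeCoeff, pairing_eq_inner (isReal_cascadeWavelet ε₀ (𝒟.ψ i) n),
    ← inner_modeProjection_eq_of_isBandLimited 𝒟 i n (cascadeWavelet_isBandLimited hε 𝒟 i n),
    hu.modeProjection_eq_modeDuhamel hε hε₀ i n ht]

/-- The complex coefficient `⟨u(t), ψ_{i,n}⟩` itself is `⟪ψ_{i,n}, V_{i,n}(t)⟫` for `t ≥ 0`. [cite: Tao2016AveragedNS, Lemma 4.1] -/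
theorem IsMildSolutionFor.pairing_eq_inner_modeDuhamel (hε₀ : 0 < ε₀) (i : Fin m) (n : ℤ) {t : ℝ}
    (ht : 0 ≤ t) :
    pairing (u t) (cascadeWavelet ε₀ (𝒟.ψ i) n) =
      ⟪cascadeWavelet ε₀ (𝒟.ψ i) n, modeDuhamel hε 𝒟 α i₀ n₀ u i n t⟫_ℂ := by
  rw [pairing_eq_inner (isReal_cascadeWavelet ε₀ (𝒟.ψ i) n),
    ← inner_modeProjection_eq_of_isBandLimited 𝒟 i n (cascadeWavelet_isBandLimited hε 𝒟 i n),
    hu.modeProjection_eq_modeDuhamel hε hε₀ i n ht]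

include hε in
/-- **The mild solution attains its datum in `L²`**: `u(0) = u₀ = ψ_{i₀,n₀}` (both lie in
`H¹⁰_df`, and `⟨u(0) - u₀, w⟩ = 0` for all `w ∈ H¹⁰_df`, in particular for `w = u(0) - u₀`). [cite: Tao2016AveragedNS, (1.15)] -/
theorem IsMildSolutionFor.mild_initial_eq : u 0 = cascadeWavelet ε₀ (𝒟.ψ i₀) n₀ := by
  set d : L2C := u 0 - cascadeWavelet ε₀ (𝒟.ψ i₀) n₀ with hd
  have hd10 : MemH10df d := (hu.1 0 self_mem_Ici).sub (𝒟.memH10df_cascadeWavelet hε i₀ n₀)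
  have h := hu.initial self_mem_Ici hd10
  rw [pairing_eq_inner hd10.2.1, pairing_eq_inner hd10.2.1] at h
  have hself : ⟪d, d⟫_ℂ = 0 := by
    rw [hd, inner_sub_right, h, sub_self]
  exact sub_eq_zero.1 (inner_self_eq_zero.1 hself)

end ModeDuhamel

/-! ### The initial projections -/

/-- **The projections of the datum**: `(ψ_{i₀,n₀})_{i,n} = ψ_{i,n}` if `(i,n) = (i₀,n₀)` and `0`
otherwise (disjoint Fourier supports), which gives (4.8)–(4.9). [cite: Tao2016AveragedNS, §4 (4.8)–(4.9)] -/
theorem modeProjection_datum (hε₀ : 0 < ε₀) (𝒟 : CascadeWaveletData ε₀ m) (i i₀ : Fin m) (n n₀ : ℤ) :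
    modeProjection 𝒟 i n (cascadeWavelet ε₀ (𝒟.ψ i₀) n₀) =
      if i = i₀ ∧ n = n₀ then cascadeWavelet ε₀ (𝒟.ψ i) n else 0 := by
  have hε : 0 < 1 + ε₀ := by linarith
  split_ifs with h
  · obtain ⟨rfl, rfl⟩ := h
    exact (cascadeWavelet_isBandLimited hε 𝒟 i n).bandProj_eq (measurableSet_freqRegion 𝒟 i n)
  · apply eq_of_fourierFn_ae_eq
    have hne : (i₀, n₀) ≠ (i, n) := fun h' => h ⟨(Prod.mk.inj h').1.symm, (Prod.mk.inj h').2.symm⟩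
    filter_upwards [fourierFn_modeProjection 𝒟 i n (cascadeWavelet ε₀ (𝒟.ψ i₀) n₀),
      fourierFn_cascadeWavelet_eq_zero_on hε₀ 𝒟 hne, fourierFn_zero] with ξ h1 h2 h3
    rw [h1, h3, Pi.zero_apply]
    by_cases hξ : ξ ∈ freqRegion 𝒟 i n
    · rw [h2 hξ, smul_zero]
    · rw [indicator_of_notMem hξ, zero_smul]

end Literature.Analysis.FluidPDE.Tao2016
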